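import Literature.AlgebraicGeometry.Deformation.CoefficientFieldOfArtinLocal
import HarnessLib

/-!
# Coefficient fields in the `k → A → κ(A)` currency: the augmentation `A → k`, its descent to `A ⧸ J`, and the
# coefficient line `(t) ≃ₗ[k] k` of a principal small extension

Layer `Literature/AlgebraicGeometry/Deformation`, namespace `Literature.AlgebraicGeometry.Deformation` (proved lemmas only; no
definition, no named fact, no instance).  Setting ([Schlessinger1968] §1, [Hartshorne2010] §6 / Thm. 10.2): `(A, 𝔪)` a local ring which
is an algebra over a field `k` such that `k → A → κ(A) = A ⧸ 𝔪` is SURJECTIVE (`hk`; it is then bijective, i.e. the image of `k` is a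
COEFFICIENT FIELD of `A` in the sense of [Lan2013PELCompactifications] Def. B.1.1.1 — the currency of the F-11 crux letters G0∕G1∕G2 of
cell `hodgecm-mathlib`), and a PRINCIPAL SMALL EXTENSION `0 → (t) → A → A ⧸ (t) → 0`, `t ≠ 0`, `𝔪 · (t) = 0`
([Schlessinger1968] Def. 1.2 (p. 209), [Hartshorne2010] Cor. 10.3).

* `charZero_of_coefficientField` — if moreover `A ⊇ ℚ`, then `k` has characteristic `0`;
* `exists_augmentation_of_coefficientField` — an augmentation `π : A →ₐ[k] k` with kernel `𝔪` (`π := e⁻¹ ∘ residue`,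
  `e : k ≃+* κ(A)`);
* `exists_quotient_augmentation_of_coefficientField` — for `J ≠ ⊤` and `A` Artinian: `π' : A ⧸ J →ₐ[k] k`, surjective, with
  NILPOTENT kernel and `mk_J⁻¹(ker π') = 𝔪` (the augmentation the smooth-lifting obstruction theory
  `Deformation/SmoothSchemeLift*` is written over);
* `exists_linearEquiv_span_singleton_symm_one` ∕ `nonempty_linearEquiv_span_singleton` — the coefficient line
  `e : (t) ≃ₗ[k] k` with `e⁻¹ 1 = t` (the `e` binder of ★ `SmoothSchemeLiftObstructionCechCocycle` ∕ `…Criterion`).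

All five are Mathlib-level algebra; the proofs of the augmentation and of the coefficient line are F0P1b-ref1 (g2)'s referee cert
`CERT-coeffField-augmentation-spanSingleton-bricksB1B2` (MONO-G1 (R39)(b) ∕ MONO-G2 bricks B1–B2), recorded here so that the G1-P and
G2-P closers import them by name.  HC_CM is proved only modulo the 7 printed citations until rung 0 closes; nothing here is about HC.

## References
* [Schlessinger1968] M. Schlessinger, *Functors of Artin rings*, Trans. AMS 130 (1968) 208–222: §1, Def. 1.2 (p. 209) (small extension).
* [Hartshorne2010] R. Hartshorne, *Deformation Theory*, GTM 257 (2010): Cor. 10.3 (p. 82), Thm. 10.2 (proof) (p. 81).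
* [Lan2013PELCompactifications] K.-W. Lan, *Arithmetic compactifications of PEL-type Shimura varieties* (2013): Def. B.1.1.1 (p. 586).
-/

noncomputable section

namespace Literature.AlgebraicGeometry.Deformation

variable {A : Type} [CommRing A] [IsLocalRing A] {k : Type} [Field k] [Algebra k A]

/-! ## §1 Characteristic and the augmentation -/

/-- **A coefficient field of a local `ℚ`-algebra has characteristic `0`** (`k ↪ κ(A) ⊇ ℚ`).
[cite: Lan2013PELCompactifications, Def. B.1.1.1 (p. 586)] -/
theorem charZero_of_coefficientField [Algebra ℚ A] : CharZero k :=
  haveI : CharZero (IsLocalRing.ResidueField A) := charZero_of_injective_algebraMap (algebraMap ℚ _).injective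
  ((IsLocalRing.residue A).comp (algebraMap k A)).charZero

/-- **The augmentation of a coefficient field** ([Lan2013PELCompactifications] Def. B.1.1.1: `k` maps isomorphically onto `κ(A)`):
if `k → A → κ(A)` is surjective there is a `k`-algebra map `π : A →ₐ[k] k` with kernel `𝔪_A` (`π := e⁻¹ ∘ residue` for the bijection
`e : k ≃+* κ(A)`).  Proof: F0P1b-ref1 (g2)'s brick B1. [cite: Lan2013PELCompactifications, Def. B.1.1.1 (p. 586)]
[cite: Hartshorne2010, Thm. 10.2 (proof), p. 81] -/
theorem exists_augmentation_of_coefficientField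
    (hk : Function.Surjective (⇑(IsLocalRing.residue A) ∘ ⇑(algebraMap k A))) :
    ∃ π : A →ₐ[k] k, RingHom.ker π.toRingHom = IsLocalRing.maximalIdeal A := by
  let φ : k →+* IsLocalRing.ResidueField A := (IsLocalRing.residue A).comp (algebraMap k A)
  have hφ : Function.Bijective φ := ⟨φ.injective, hk⟩
  let e : k ≃+* IsLocalRing.ResidueField A := RingEquiv.ofBijective φ hφ
  let π₀ : A →+* k := (e.symm : IsLocalRing.ResidueField A →+* k).comp (IsLocalRing.residue A)
  refine ⟨{ toRingHom := π₀, commutes' := fun c => ?_ }, ?_⟩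
  · change e.symm (IsLocalRing.residue A (algebraMap k A c)) = c
    exact e.symm_apply_apply c
  · ext a
    rw [RingHom.mem_ker]
    change e.symm (IsLocalRing.residue A a) = 0 ↔ _
    rw [map_eq_zero_iff _ e.symm.injective, IsLocalRing.residue_eq_zero_iff]

/-- **The augmentation descends to every proper quotient of an Artinian local algebra**: for `J ≠ ⊤` there is
`π' : A ⧸ J →ₐ[k] k`, surjective, with NILPOTENT kernel (`ker π' = mk_J(𝔪_A)` and `𝔪_A` is nilpotent, ★
`isNilpotent_maximalIdeal_of_isArtinianRing`) and `mk_J⁻¹(ker π') = 𝔪_A` — the shape `(π', IsNilpotent (ker π'))` over which the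
smooth-lifting obstruction theory is typed ([Hartshorne2010] Thm. 10.2: `A'` an Artinian `k`-algebra with residue field `k`).
[cite: Hartshorne2010, Thm. 10.2 (proof), p. 81] [cite: Lan2013PELCompactifications, Def. B.1.1.1 (p. 586)] -/
theorem exists_quotient_augmentation_of_coefficientField [IsArtinianRing A]
    (hk : Function.Surjective (⇑(IsLocalRing.residue A) ∘ ⇑(algebraMap k A))) {J : Ideal A} (hJ : J ≠ ⊤) :
    ∃ π' : (A ⧸ J) →ₐ[k] k, Function.Surjective π' ∧ IsNilpotent (RingHom.ker π') ∧
      (RingHom.ker π').comap (Ideal.Quotient.mk J) = IsLocalRing.maximalIdeal A := by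
  obtain ⟨π, hπ⟩ := exists_augmentation_of_coefficientField hk
  have hJle : J ≤ IsLocalRing.maximalIdeal A := IsLocalRing.le_maximalIdeal hJ
  have hJker : ∀ a : A, a ∈ J → π a = 0 := fun a ha => by
    have h : a ∈ RingHom.ker π.toRingHom := hπ ▸ hJle ha
    exact h
  let π' : (A ⧸ J) →ₐ[k] k := Ideal.Quotient.liftₐ J π hJker
  have hπ'mk : ∀ a, π' (Ideal.Quotient.mk J a) = π a := fun a => rfl
  have hcomap : (RingHom.ker π').comap (Ideal.Quotient.mk J) = IsLocalRing.maximalIdeal A := by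
    ext a
    rw [Ideal.mem_comap, RingHom.mem_ker, hπ'mk, ← hπ, RingHom.mem_ker]
    exact Iff.rfl
  refine ⟨π', fun c => ⟨Ideal.Quotient.mk J (algebraMap k A c), by rw [hπ'mk]; exact π.commutes c⟩, ?_, hcomap⟩
  have hker : RingHom.ker π' = (IsLocalRing.maximalIdeal A).map (Ideal.Quotient.mk J) := by
    rw [← hcomap, Ideal.map_comap_of_surjective _ Ideal.Quotient.mk_surjective]
  obtain ⟨n, hn⟩ := isNilpotent_maximalIdeal_of_isArtinianRing (A := A)
  refine ⟨n, ?_⟩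
  rw [hker, ← Ideal.map_pow, hn, Ideal.zero_eq_bot, Ideal.map_bot, Ideal.zero_eq_bot]

/-! ## §2 The coefficient line of a principal small extension -/

/-- **The coefficient line**: for a principal small extension (`t ≠ 0`, `𝔪_A · (t) = 0`; [Schlessinger1968] Def. 1.2) of a local ring
with a coefficient field `k`, the ideal `(t)` is a `k`-LINE: there is `e : (t) ≃ₗ[k] k` with `e⁻¹ 1 = t` (the inverse of `a ↦ a · t`,
injective as `k ⊆ A^×`, onto as `A = k + 𝔪_A` and `𝔪_A t = 0`).  Proof: F0P1b-ref1 (g2)'s brick B2.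
[cite: Schlessinger1968, §1 Def. 1.2 (p. 209)] [cite: Hartshorne2010, Cor. 10.3, p. 82 (the obstruction for a principal small extension)] -/
theorem exists_linearEquiv_span_singleton_symm_one
    (hk : Function.Surjective (⇑(IsLocalRing.residue A) ∘ ⇑(algebraMap k A)))
    (t : A) (ht0 : t ≠ 0) (hmt : IsLocalRing.maximalIdeal A * Ideal.span {t} = ⊥) :
    ∃ e : ↥((Ideal.span {t}).restrictScalars k) ≃ₗ[k] k, ((e.symm 1 : ↥((Ideal.span {t}).restrictScalars k)) : A) = t := by
  let f : k →ₗ[k] ↥((Ideal.span {t}).restrictScalars k) :=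
    { toFun := fun a => ⟨algebraMap k A a * t, Ideal.mul_mem_left _ _ (Ideal.subset_span rfl)⟩
      map_add' := fun a b => by ext; simp [add_mul]
      map_smul' := fun a b => by ext; simp [Algebra.smul_def, mul_assoc] }
  have hf : ∀ a, ((f a : ↥((Ideal.span {t}).restrictScalars k)) : A) = algebraMap k A a * t := fun a => rfl
  have hinj : Function.Injective f := by
    intro a b hab
    by_contra hne
    have hu : IsUnit (algebraMap k A (a - b)) := (IsUnit.mk0 _ (sub_ne_zero.mpr hne)).map _
    apply ht0
    have h0 : algebraMap k A (a - b) * t = 0 := by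
      have h1 : algebraMap k A a * t = algebraMap k A b * t := by rw [← hf, ← hf, hab]
      rw [map_sub, sub_mul, sub_eq_zero]
      exact h1
    exact hu.mul_right_eq_zero.mp h0
  have hsurj : Function.Surjective f := by
    rintro ⟨x, hx⟩
    obtain ⟨c, rfl⟩ := Ideal.mem_span_singleton'.mp (show x ∈ Ideal.span {t} from hx)
    obtain ⟨a, ha⟩ := hk (IsLocalRing.residue A c)
    refine ⟨a, Subtype.ext ?_⟩
    rw [hf]
    have hmem : c - algebraMap k A a ∈ IsLocalRing.maximalIdeal A := by
      rw [← IsLocalRing.residue_eq_zero_iff, map_sub, sub_eq_zero]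
      exact ha.symm
    have hz : (c - algebraMap k A a) * t = 0 := by
      have h := Ideal.mul_mem_mul hmem (Ideal.subset_span (s := ({t} : Set A)) rfl)
      rw [hmt] at h
      exact Ideal.mem_bot.mp h
    rw [sub_mul, sub_eq_zero] at hz
    exact hz.symm
  refine ⟨(LinearEquiv.ofBijective f ⟨hinj, hsurj⟩).symm, ?_⟩
  rw [LinearEquiv.symm_symm, LinearEquiv.ofBijective_apply, hf, map_one, one_mul]

/-- The coefficient line, existence form `Nonempty ((t) ≃ₗ[k] k)` — the `e` binder of ★ F2∕F3a
(`SmoothSchemeLiftObstructionCechCocycle` ∕ `…Criterion`). [cite: Hartshorne2010, Cor. 10.3, p. 82 (the obstruction for a principal small extension)] -/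
theorem nonempty_linearEquiv_span_singleton
    (hk : Function.Surjective (⇑(IsLocalRing.residue A) ∘ ⇑(algebraMap k A)))
    (t : A) (ht0 : t ≠ 0) (hmt : IsLocalRing.maximalIdeal A * Ideal.span {t} = ⊥) :
    Nonempty (↥((Ideal.span {t}).restrictScalars k) ≃ₗ[k] k) :=
  let ⟨e, _⟩ := exists_linearEquiv_span_singleton_symm_one hk t ht0 hmt
  ⟨e⟩

end Literature.AlgebraicGeometry.Deformation

end
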